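import Summits.MatrixMultiplication.OmegaCensus.STPPKneserFilter

/-!
# ω-census (abelian STPP census, seat stpp-2), filter N9: the Kneser packing condition in full `(J, K)` form (kernel)

HONEST FRAMING (pub-omega census; verbatim): lottery ticket; floor = certified bounds/negative ranges.
Census BOOKKEEPING (pub-omega stpp-2 gen 21, 2026-08-27).  A necessary condition ("filter N9") for the finite STPP census of
abelian groups, in the kernel, generalising filter N8 (`STPPKneserFilter.lean`, stpp-2 gen 20) from its three index shapes to ALL
pairs of index sets.  Nothing here is progress on `ω`.

Setting as in `STPPKneserFilter.lean`: an STPP family `(Aᵢ, Bᵢ, Cᵢ)_{i<N}` (CKSU 2005 Def. 5.1, the tree's `IsSTPP`) with non-empty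
sets in a finite additive abelian group `H`, `Xᵢ = Bᵢ − Aᵢ`, `Yᵢ = Cᵢ − Bᵢ`, `Zᵢ = Cᵢ − Aᵢ` (`STPPKneser.D`), so that
`x + y = z` with `x ∈ X_j`, `y ∈ Y_k`, `z ∈ Zᵢ` forces `i = j = k` (`indices_eq_of_add_eq`).  Hence (§1, `KJK`) for ALL index
sets `J, K`:
  `(⋃_{j ∈ J} X_j) + (⋃_{k ∈ K} Y_k) ⊆ H ∖ ⋃_{i ∉ J ∩ K} Zᵢ`,
and by Kneser (`false_of_kneserLB_gt`): if `J, K ≠ ∅` and `min_{d ∣ |H|} (⌈Σ_J a b / d⌉ + ⌈Σ_K b c / d⌉ − 1)·d > |H| − Σ_{i ∉ J∩K} a c`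
then no STPP family with these cards exists (§2, `not_isSTPP_of_n9DeadAt`, with the numeric side the DECIDABLE predicate
`N9DeadAt n N a b c J K` on the card vectors and Boolean indicators `J K : Fin N → Bool`; the three readings `x + y = z`,
`z − y = x`, `z − x = y` are the rotations `(A,B,C) ↦ (B,C,A) ↦ (C,A,B)` as in N8, selector `N9Dead … rot J K`).  Filter N8 is the
special case `(J, K) ∈ {(all, all ∖ j), (all ∖ j, all), ({j}, {k})}`.  Design: the index sets enter as explicit WITNESSES (found
by the census tool `gkneser.py`, stpp-2 g21, which enumerates the `3·3^N` maximal instances), so each per-leaf theorem is one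
`decide` on a single inequality chain — no search in the kernel.  §3: two leaves of the cell's ℤ₅₇ frontier of record (2 128
leaves under N1–N8; 1 308 of them are N9-dead) decided by this filter; the per-leaf tables follow in sibling files when the
frontier is final.
-/

open Finset
open scoped Pointwise

namespace Summit.MatrixMultiplication.OmegaCensus.STPPKneser

open Literature.Computability.AlgebraicComplexity

/-! ## §1 The general sumset inclusion -/

section Families

variable {H : Type*} [AddCommGroup H] [DecidableEq H] {N : ℕ} {A B C : Fin N → Finset H}

/-- The index set `{i | J i}` of a Boolean indicator on `Fin N`. [folklore] -/
def idx (N : ℕ) (J : Fin N → Bool) : Finset (Fin N) := Finset.univ.filter fun i => J i = true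

/-- Membership in `idx`. [folklore] -/
theorem mem_idx {J : Fin N → Bool} {i : Fin N} : i ∈ idx N J ↔ J i = true := by
  simp [idx]

/-- `idx` of an indicator with a `true` value is non-empty. [folklore] -/
theorem idx_nonempty {J : Fin N → Bool} (h : ∃ j, J j = true) : (idx N J).Nonempty := by
  obtain ⟨j, hj⟩ := h
  exact ⟨j, mem_idx.2 hj⟩

/-- **(KJK)** For ALL index sets `J, K`: `(⋃_{j∈J} X_j) + (⋃_{k∈K} Y_k) ⊆ H ∖ ⋃_{i ∉ J∩K} Zᵢ` — a sum `x + y` with `x ∈ X_j`, `y ∈ Y_k`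
can lie in `Zᵢ` only if `i = j = k ∈ J ∩ K`.  (K1a), (K1b), (K2) of `STPPKneserFilter.lean` are the cases `(all, all ∖ j)`,
`(all ∖ j, all)`, `({j}, {k})`. [cite: CohnKleinbergSzegedyUmans2005, Def. 5.1] -/
theorem KJK [Fintype H] (hS : IsSTPP A B C) (J K : Fin N → Bool) :
    DU A B (idx N J) + DU B C (idx N K) ⊆ Finset.univ \ DU A C (idx N fun i => !(J i && K i)) := by
  intro w hw
  rw [Finset.mem_sdiff]
  refine ⟨Finset.mem_univ _, fun hz => ?_⟩
  obtain ⟨x, hx, y, hy, rfl⟩ := Finset.mem_add.1 hw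
  obtain ⟨i, hi, hx⟩ := Finset.mem_biUnion.1 hx
  obtain ⟨k, hk, hy⟩ := Finset.mem_biUnion.1 hy
  obtain ⟨j, hj, hz⟩ := Finset.mem_biUnion.1 hz
  have h := indices_eq_of_add_eq hS hx hy hz rfl
  rw [mem_idx] at hi hk hj
  rw [h.1] at hi
  rw [h.2] at hk
  rw [hi, hk] at hj
  exact Bool.false_ne_true hj

end Families

/-! ## §2 The decidable numeric predicate and the filter theorem -/

section Filter

/-- Filter N9 at the witness `(J, K)`, reading `x + y = z`, on the card vectors `(a, b, c)` of a pattern in a group of order `n`: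
`J, K ≠ ∅` and for EVERY candidate period `d ∣ n`, `n − Σ_{i ∉ J∩K} aᵢcᵢ < kneserLB (Σ_{J} aᵢbᵢ) (Σ_{K} bᵢcᵢ) d`
(bounded quantifier, decidable).  Mirror of the census tool `gkneser.py` (stpp-2 g21). [folklore] -/
def N9DeadAt (n N : ℕ) (a b c : Fin N → ℕ) (J K : Fin N → Bool) : Bool :=
  decide ((∃ j, J j = true) ∧ (∃ k, K k = true) ∧
    ∀ d : ℕ, d < n + 1 → d ∣ n → 0 < d →
      n - (∑ i, if (!(J i && K i)) = true then a i * c i else 0) <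
        kneserLB (∑ i, if J i = true then a i * b i else 0) (∑ i, if K i = true then b i * c i else 0) d)

/-- **Filter N9** with a reading selector: `rot = 0, 1, 2` applies `N9DeadAt` to `(a,b,c)`, `(b,c,a)`, `(c,a,b)` (the census's
readings `x + y = z`, `z − y = x`, `z − x = y`). [folklore] -/
def N9Dead (n N : ℕ) (a b c : Fin N → ℕ) (rot : ℕ) (J K : Fin N → Bool) : Bool :=
  if rot = 0 then N9DeadAt n N a b c J K else if rot = 1 then N9DeadAt n N b c a J K else N9DeadAt n N c a b J K

variable {H : Type*} [AddCommGroup H] [DecidableEq H] [Fintype H] {N : ℕ} {A B C : Fin N → Finset H}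

/-- **Filter N9, one reading (kernel).** An STPP family with non-empty sets whose card vectors satisfy `N9DeadAt |H| … J K` for
some index sets `J, K` does not exist: the sumset `(⋃_J X) + (⋃_K Y)` (of cardinality `≥ kneserLB` for the period
`d = |Stab|`, Kneser) would have to fit into `H ∖ ⋃_{i∉J∩K} Zᵢ`. [cite: Kneser1953] [cite: CohnKleinbergSzegedyUmans2005, Def. 5.1] -/
theorem not_isSTPP_of_n9DeadAt (hS : IsSTPP A B C) (hA : ∀ i, (A i).Nonempty) (hB : ∀ i, (B i).Nonempty)
    (hC : ∀ i, (C i).Nonempty) {n : ℕ} (hn : Fintype.card H = n) {a b c : Fin N → ℕ} (ha : ∀ i, #(A i) = a i)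
    (hb : ∀ i, #(B i) = b i) (hc : ∀ i, #(C i) = c i) {J K : Fin N → Bool} (hdead : N9DeadAt n N a b c J K = true) :
    False := by
  obtain ⟨hJ, hK, h⟩ := of_decide_eq_true hdead
  have hZ : #(Finset.univ \ DU A C (idx N fun i => !(J i && K i))) =
      n - ∑ i, if (!(J i && K i)) = true then a i * c i else 0 := by
    rw [Finset.card_sdiff_of_subset (Finset.subset_univ _), Finset.card_univ, hn, card_DU_AC hS hB, idx,
      Finset.sum_filter]
    simp_rw [ha, hc]
  have conv : ∀ {s t u : ℕ}, (∀ d : ℕ, d < n + 1 → d ∣ n → 0 < d → u < kneserLB s t d) →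
      ∀ d ∈ Nat.divisors (Fintype.card H), u < kneserLB s t d := by
    intro s t u hall d hd
    rw [hn, Nat.mem_divisors] at hd
    exact hall d (Nat.lt_succ_of_le (Nat.le_of_dvd (Nat.pos_of_ne_zero hd.2) hd.1)) hd.1
      (Nat.pos_of_dvd_of_pos hd.1 (Nat.pos_of_ne_zero hd.2))
  refine false_of_kneserLB_gt (DU A B (idx N J)) (DU B C (idx N K)) _ (DU_nonempty (idx_nonempty hJ) hA hB)
    (DU_nonempty (idx_nonempty hK) hB hC) (KJK hS J K) ?_
  rw [hZ, card_DU_AB hS hC, card_DU_BC hS hA, idx, idx, Finset.sum_filter, Finset.sum_filter]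
  simp_rw [ha, hb, hc]
  exact conv h

/-- **Filter N9 (kernel): an STPP family with non-empty sets in a finite abelian group `H` whose pattern is `N9Dead |H| … rot J K`
for some reading `rot` and index sets `J, K` does not exist** — readings via the rotations `(A,B,C) ↦ (B,C,A) ↦ (C,A,B)`
(`stpp_rotate`). [cite: Kneser1953] [cite: CohnKleinbergSzegedyUmans2005, Def. 5.1] -/
theorem not_isSTPP_of_n9Dead (hS : IsSTPP A B C) (hA : ∀ i, (A i).Nonempty) (hB : ∀ i, (B i).Nonempty)
    (hC : ∀ i, (C i).Nonempty) {n : ℕ} (hn : Fintype.card H = n) {a b c : Fin N → ℕ} (ha : ∀ i, #(A i) = a i)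
    (hb : ∀ i, #(B i) = b i) (hc : ∀ i, #(C i) = c i) {rot : ℕ} {J K : Fin N → Bool}
    (hdead : N9Dead n N a b c rot J K = true) : False := by
  unfold N9Dead at hdead
  split_ifs at hdead with h0 h1
  · exact not_isSTPP_of_n9DeadAt hS hA hB hC hn ha hb hc hdead
  · exact not_isSTPP_of_n9DeadAt (stpp_rotate hS) hB hC hA hn hb hc ha hdead
  · exact not_isSTPP_of_n9DeadAt (stpp_rotate (stpp_rotate hS)) hC hA hB hn hc ha hb hdead

/-- Card-vector form with literal vectors: non-emptiness comes from positivity of the entries; `rot`, `J`, `K` are the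
witness found by the census tool. [cite: Kneser1953] -/
theorem not_isSTPP_of_n9Dead' (hS : IsSTPP A B C) {n : ℕ} (hn : Fintype.card H = n) (a b c : Fin N → ℕ)
    (ha : ∀ i, #(A i) = a i) (hb : ∀ i, #(B i) = b i) (hc : ∀ i, #(C i) = c i)
    (hpos : ∀ i, 0 < a i ∧ 0 < b i ∧ 0 < c i) (rot : ℕ) (J K : Fin N → Bool)
    (hdead : N9Dead n N a b c rot J K = true) : False :=
  not_isSTPP_of_n9Dead hS (fun i => Finset.card_pos.1 ((ha i).symm ▸ (hpos i).1))
    (fun i => Finset.card_pos.1 ((hb i).symm ▸ (hpos i).2.1)) (fun i => Finset.card_pos.1 ((hc i).symm ▸ (hpos i).2.2))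
    hn ha hb hc hdead

end Filter

/-! ## §3 Examples: two ℤ₅₇ frontier leaves that pass N1–N8 and die under N9 -/

section Examples

variable {H : Type*} [AddCommGroup H] [DecidableEq H] [Fintype H]

/-- The ℤ₅₇ frontier leaf `{(1,2,3), (2,2,2), (2,2,3), (8,2,2)}` (`∑ abc = 58 > 57`; N8-alive) carries no STPP family in ANY abelian
group of order `57`: reading `x + y = z` with `J = {0,1,3}`, `K = {0,1,2}` reads "a `22`-set plus a `16`-set avoiding the `22`-set
`Z₂ ∪ Z₃`", and `min_{d ∣ 57} kneserLB 22 16 d = 37 > 35`. [cite: Kneser1953] [cite: CohnKleinbergSzegedyUmans2005, Def. 5.1] -/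
theorem no_isSTPP_Z57_123_222_223_822 (hH : Fintype.card H = 57) (A B C : Fin 4 → Finset H) (hS : IsSTPP A B C)
    (hA : ∀ i, #(A i) = ![1, 2, 2, 8] i) (hB : ∀ i, #(B i) = ![2, 2, 2, 2] i) (hC : ∀ i, #(C i) = ![3, 2, 3, 2] i) :
    False :=
  not_isSTPP_of_n9Dead' hS hH _ _ _ hA hB hC (by decide) 0 ![true, true, false, true] ![true, true, true, false]
    (by decide)

/-- The ℤ₅₇ frontier leaf `{(1,1,2), (2,2,4), (2,2,7), (2,3,2)}` (`∑ abc = 58`; N8-alive): reading `x + y = z`, `J = {0,3}`, `K = {0,1,2,3}`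
(`J ∩ K = {0,3}`, avoid `Z₁ ∪ Z₂` of size `22`): `min_{d ∣ 57} kneserLB 7 30 d = 36 > 35`. [cite: Kneser1953] [cite: CohnKleinbergSzegedyUmans2005, Def. 5.1] -/
theorem no_isSTPP_Z57_112_224_227_232 (hH : Fintype.card H = 57) (A B C : Fin 4 → Finset H) (hS : IsSTPP A B C)
    (hA : ∀ i, #(A i) = ![1, 2, 2, 2] i) (hB : ∀ i, #(B i) = ![1, 2, 2, 3] i) (hC : ∀ i, #(C i) = ![2, 4, 7, 2] i) :
    False :=
  not_isSTPP_of_n9Dead' hS hH _ _ _ hA hB hC (by decide) 0 ![true, false, false, true] ![true, true, true, true]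
    (by decide)

end Examples

end Summit.MatrixMultiplication.OmegaCensus.STPPKneser
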